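import Summits.QuantumFields.YangMills.Theorems.UnitScaleTiltProp7CombSymBCHDoorT3
import Summits.QuantumFields.YangMills.Theorems.UnitScaleTiltProp7CombSymLinearPartT3
import Summits.QuantumFields.YangMills.Theorems.UnitScaleTiltProp7DbarTwWindow
import Summits.QuantumFields.YangMills.Theorems.UnitScaleTiltProp7GaugeTwistLogRatio
import Literature.MathematicalPhysics.QuantumFieldTheory.Balaban1983to89.B7Prop6Flat
import Literature.MathematicalPhysics.QuantumFieldTheory.Balaban1983to89.B9Eq3114Proof
import Literature.MathematicalPhysics.QuantumFieldTheory.Balaban1983to89.B7Prop7LinearBound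
import HarnessLib

/-!
# Route `UnitScaleTilt`, crux K1 «MinimiserStabilityRegPr» (stmt-QuantumFields-19200), route-R E′ (A′)-on-Σ, P-A2-COMB (β) — file (β-ii′) «R12-DOOR»:
# **THE TWO FRAME-RATIO ROWS (R1)(R2) OF THE BCH DOOR ARE ONE PER-SITE ROW (R0)**, and (RL)∕(Rq) are discharged

Cell `ym3-torus` (HUMAN RULING D-0037: YM₃ on the torus is ladder rung R3 — not d = 4, not a mass gap, not Clay), width seat `ym3-torus-px16` (gen 5), LOCATE
`LOCATE-R0-FRAME-RATIO-px16g5.md` (19200 evidence #53).  `--supports stmt-QuantumFields-19200 --as helper`; THEOREMS ONLY (0 `def`, 0 `sorry`); count-neutral.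
Kinematics over landed letters; the analytic per-site row (R0) is NOT proved here (sized L in the LOCATE); nothing of P-A2, `hPA2`, `hcoS`, E′, EX, the crux, d = 4 or the gap is claimed.

THE PRINT.  [Balaban1985Averaging] (26)–(27) p. 22 (logarithm near `1`; `log X⁻¹ = −log X`; unitary equivalence of logarithms p. 24), (89)–(92) p. 31 (two frame families differ by a
coarse gauge transformation), (5) p. 18 (each site is the initial∕final point of `d` positive bonds); [Balaban1985Variational] (44) p. 285.

WHY.  The door of record ✓`Prop7CombSymBCHDoor.sum_norm_CmapTw_sub_CmapTwS_le` (px18 g3) displays, besides the sup windows, THREE rows about the coarse-site frame ratio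
`g_A(y) := w_c(A)(y)⁻¹·w_s(A)(y)` (`frameTw⁻¹·frameTwS`): the linear-part identity (RL) and the two second-order rows (R1) at `c₋`, (R2) at `c₊` (the latter conjugated by `D̄₀(c)`).
(RL) is ★routeR-w2 g8's ✓`Prop7CombSymLinearPart.QTw_sub_QTwS_apply_eq_descendToGL` (`ℓ₁ c = (r_s − r_c)(c₋)A`, `ℓ₂ c = −D̄₀(c)·(r_s − r_c)(c₊)A·D̄₀(c)⁻¹`); with these letters the
(R2) summand IS the (R1)-type quantity at `c₊`: `log(D̄₀·g⁻¹·D̄₀⁻¹) − ℓ₂ = −D̄₀·(log g − (r_s − r_c)A)·D̄₀⁻¹` (lit ✓`B7Prop6Flat.mlog_conj`, lit ✓`B9Eq3114Proof.mlog_units_inv`) and `D̄₀(c)` is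
special unitary at a printed-regular background (✓`Prop7DbarTwWindow.descendToGL_bgUnits_mem_specialUnitaryUnits_of_regPr`), so its norm is `‖log g(c₊) − (r_s − r_c)(c₊)A‖`.  Counting
bonds by initial and final points (✓`Prop7GaugeTwistLogRatio.sum_pbond_src∕_tgt`, `d = 3`) both rows become `3·Σ_y ρ(y)` for ONE per-site row (R0) `‖log g_A(y) − (r_s − r_c)(y)A‖ ≤ ρ(y)`;
and (Rq) follows from (Rp) (`‖D̄₀g⁻¹D̄₀⁻¹ − 1‖ = ‖g⁻¹ − 1‖ ≤ 2p`, lit ✓`B7Prop7LinearBound.norm_units_inv_sub_one_le_two_mul`).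

WHAT IS PROVED (ns `…Theorems.Prop7CombSymR12OfSiteRow`; T³, `SU(2)`).
* §1 matrix letters: `mlog_conj_inv_sub_neg_conj_eq`, `norm_units_conj_eq_of_mem_specialUnitaryUnits`, `norm_units_conj_inv_sub_one_le`.
* §2 ★ `norm_R2_summand_eq` — the (R2) summand at the (RL) letters equals `‖mlog ↑g_A(c₊) − (r_s − r_c)(c₊)A‖`; ★ `sum_R1_le`, `sum_R2_le` — both rows `≤ 3·Σ_y ρ y` from (R0).
* §3 ★★★ `sum_norm_CmapTw_sub_CmapTwS_le_of_siteRow` — THE (β) DOOR WITH ONE ANALYTIC ROW: at `RegPr F n K ε₀ W` (`10¹⁰L⁶ε₀ ≤ 1`, `10¹²L³ε₀ ≤ 1`), for bondwise skew-adjoint traceless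
  `A`, sup windows (Rp) `‖g_A(y) − 1‖ ≤ p y ≤ 1∕60`, (Rz) `‖U̿^{twS}(A)(c) − 1‖ ≤ z c ≤ 1∕30`, and (R0): `Σ_c ‖CmapTw W A c − CmapTwS W A c‖ ≤ 6·Σ_y ρ y + Σ_c (4(p c₋ + z c)² + 4(p c₋ + z c + p c₋·z c + 2p c₊)²)`.
HONEST SCOPE.  Algebra + bond counting over landed theorems; no estimate of Bałaban's asserted; (R0) in the E2E currency `c₁ℓ⁻¹M + c₂ℓ(K+dv)` is an L-sized two-tower item (LOCATE §2).

References: T. Bałaban, CMP **98** (1985) 17–51 [Balaban1985Averaging] ((5) p.18, (21) p.21, (26)–(27) p.22, p.24, (89)–(92) p.31, (97) p.32, (125)–(127) p.36); CMP **99** (1985)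
389–434 [Balaban1985BackgroundPropagators] ((3.14)–(3.15) p.393, p.418); CMP **102** (1985) 277–309 [Balaban1985Variational] ((44)–(48) p.285); CMP **109** (1987) 249–301 [Balaban1987RG1] ((0.4) p.253).
-/

set_option autoImplicit false

noncomputable section

open scoped BigOperators Matrix.Norms.L2Operator Matrix

namespace Summit.QuantumFields.YangMills.Theorems.Prop7CombSymR12OfSiteRow

open Literature.MathematicalPhysics.QuantumFieldTheory.Balaban1983to89
open Literature.MathematicalPhysics.QuantumFieldTheory.Balaban1983to89.T3ContinuumYM3Torus
open MatrixLog (mlog)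
open T3SectALandauChart (bgUnits)
open T3PrintedRegularMinimiser (RegPr)
open B7Prop2SpecialUnitary (specialUnitaryUnits specialUnitaryUnits_le_unitaryUnits)
open B7Prop6Flat (mlog_conj)
open B9Eq3114Proof (mlog_units_inv)
open B7Prop7LinearBound (norm_units_inv_sub_one_le_two_mul)
open Summit.QuantumFields.YangMills.Theorems.Prop7SymAvgGL (descendToGL)
open Summit.QuantumFields.YangMills.Theorems.Prop7SymAvgTw (frameTw QTw CmapTw)
open Summit.QuantumFields.YangMills.Theorems.Prop7SymAvgTwSym (frameTwS dbarTwS QTwS CmapTwS)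
open Summit.QuantumFields.YangMills.Theorems.Prop7CombSymBCHDoor (sum_norm_CmapTw_sub_CmapTwS_le)
open Summit.QuantumFields.YangMills.Theorems.Prop7CombSymLinearPart (QTw_sub_QTwS_apply_eq_descendToGL ten7_of_ten12)
open Summit.QuantumFields.YangMills.Theorems.Prop7DbarTwWindow (descendToGL_bgUnits_mem_specialUnitaryUnits_of_regPr)
open Summit.QuantumFields.YangMills.Theorems.Prop7GaugeTwistLogRatio (sum_pbond_src sum_pbond_tgt)

/-! ## §1 Matrix letters: the logarithm of a conjugated inverse, unitary conjugation is isometric -/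

section Letters

/-- `log(u·g⁻¹·u⁻¹) + u·r·u⁻¹ = −u·(log g − r)·u⁻¹` for units `u, g` of `M₂(ℂ)` with `‖g − 1‖ < ½` (the series logarithm commutes with conjugation by ANY unit, lit ✓`B7Prop6Flat.mlog_conj`,
and `log g⁻¹ = −log g`, lit ✓`B9Eq3114Proof.mlog_units_inv`). [cite: Balaban1985Averaging, (21) p.21, (26)-(27) p.22, p.24] -/
theorem mlog_conj_inv_sub_neg_conj_eq (u g : (Matrix (Fin 2) (Fin 2) ℂ)ˣ) (hg : ‖(g : Matrix (Fin 2) (Fin 2) ℂ) - 1‖ < 1 / 2) (r : Matrix (Fin 2) (Fin 2) ℂ) :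
    mlog ((u * g⁻¹ * u⁻¹ : (Matrix (Fin 2) (Fin 2) ℂ)ˣ) : Matrix (Fin 2) (Fin 2) ℂ)
        - -((u : Matrix (Fin 2) (Fin 2) ℂ) * r * ((u⁻¹ : (Matrix (Fin 2) (Fin 2) ℂ)ˣ) : Matrix (Fin 2) (Fin 2) ℂ))
      = -((u : Matrix (Fin 2) (Fin 2) ℂ) * (mlog (g : Matrix (Fin 2) (Fin 2) ℂ) - r) * ((u⁻¹ : (Matrix (Fin 2) (Fin 2) ℂ)ˣ) : Matrix (Fin 2) (Fin 2) ℂ)) := by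
  rw [Units.val_mul, Units.val_mul, mlog_conj u, mlog_units_inv hg]
  noncomm_ring

/-- Conjugation by a special-unitary unit is isometric: `‖u·Y·u⁻¹‖ = ‖Y‖` (C⋆-identity; `u⁻¹ ∈ SU(2)` as well). [cite: Balaban1985Averaging, (19)-(20) p.21] -/
theorem norm_units_conj_eq_of_mem_specialUnitaryUnits {u : (Matrix (Fin 2) (Fin 2) ℂ)ˣ} (hu : u ∈ specialUnitaryUnits (Fin 2)) (Y : Matrix (Fin 2) (Fin 2) ℂ) :
    ‖(u : Matrix (Fin 2) (Fin 2) ℂ) * Y * ((u⁻¹ : (Matrix (Fin 2) (Fin 2) ℂ)ˣ) : Matrix (Fin 2) (Fin 2) ℂ)‖ = ‖Y‖ := by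
  have hU : (u : Matrix (Fin 2) (Fin 2) ℂ) ∈ unitary (Matrix (Fin 2) (Fin 2) ℂ) :=
    B7Prop2Explicit.mem_unitaryUnits.mp (specialUnitaryUnits_le_unitaryUnits hu)
  have hUi : ((u⁻¹ : (Matrix (Fin 2) (Fin 2) ℂ)ˣ) : Matrix (Fin 2) (Fin 2) ℂ) ∈ unitary (Matrix (Fin 2) (Fin 2) ℂ) :=
    B7Prop2Explicit.mem_unitaryUnits.mp (specialUnitaryUnits_le_unitaryUnits ((specialUnitaryUnits (Fin 2)).inv_mem hu))
  rw [CStarRing.norm_mul_mem_unitary _ hUi, CStarRing.norm_mem_unitary_mul _ hU]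

/-- `‖u·g⁻¹·u⁻¹ − 1‖ ≤ 2p` for `u ∈ SU(2)`, `‖g − 1‖ ≤ p ≤ ½`: conjugation is isometric and `‖g⁻¹ − 1‖ ≤ 2‖g − 1‖` (lit ✓`norm_units_inv_sub_one_le_two_mul`) — (Rq) of the BCH door from (Rp).
[cite: Balaban1985Averaging, (27) p.22, p.24] -/
theorem norm_units_conj_inv_sub_one_le {u g : (Matrix (Fin 2) (Fin 2) ℂ)ˣ} (hu : u ∈ specialUnitaryUnits (Fin 2)) {p : ℝ}
    (hg : ‖(g : Matrix (Fin 2) (Fin 2) ℂ) - 1‖ ≤ p) (hp : p ≤ 1 / 2) :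
    ‖((u * g⁻¹ * u⁻¹ : (Matrix (Fin 2) (Fin 2) ℂ)ˣ) : Matrix (Fin 2) (Fin 2) ℂ) - 1‖ ≤ 2 * p := by
  have h1 : ((u * g⁻¹ * u⁻¹ : (Matrix (Fin 2) (Fin 2) ℂ)ˣ) : Matrix (Fin 2) (Fin 2) ℂ) - 1
      = (u : Matrix (Fin 2) (Fin 2) ℂ) * (((g⁻¹ : (Matrix (Fin 2) (Fin 2) ℂ)ˣ) : Matrix (Fin 2) (Fin 2) ℂ) - 1) * ((u⁻¹ : (Matrix (Fin 2) (Fin 2) ℂ)ˣ) : Matrix (Fin 2) (Fin 2) ℂ) := by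
    rw [Units.val_mul, Units.val_mul, mul_sub, sub_mul, mul_one, Units.mul_inv]
  rw [h1, norm_units_conj_eq_of_mem_specialUnitaryUnits hu]
  exact norm_units_inv_sub_one_le_two_mul g hg hp

end Letters

/-! ## §2 The (R2) summand at the (RL) letters is the (R1)-type quantity at `c₊`; both rows from the per-site row (R0) -/

section Rows

variable (F : T3Family) {n K : ℕ} (h : n ≤ K)

/-- ★ **THE (R2) SUMMAND AT THE (RL) LETTERS OF RECORD IS `‖log g_A(c₊) − (r_s − r_c)(c₊)A‖`**: for `RegPr F n K ε₀ W` (`10⁷L³ε₀ ≤ 1`, so `D̄₀(c) ∈ SU(2)`) and `‖g_A(c₊) − 1‖ < ½`,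
`‖mlog ↑(D̄₀(c)·g_A(c₊)⁻¹·D̄₀(c)⁻¹) − ℓ₂ c‖ = ‖mlog ↑g_A(c₊) − (r_s − r_c)(c₊)A‖` with `ℓ₂ c = −(↑D̄₀(c)·(r_s − r_c)(c₊)A·↑D̄₀(c)⁻¹)`, `r_•(y)A := fderiv ℂ (A ↦ ↑(frame•(A)(y))) 0 A`.
[cite: Balaban1985Averaging, (89)-(92) p.31, (26)-(27) p.22, p.24; Balaban1987RG1, (0.4) p.253] -/
theorem norm_R2_summand_eq {ε₀ : ℝ} (hε₀ : 0 < ε₀) (hε7 : 10 ^ 7 * (F.L : ℝ) ^ 3 * ε₀ ≤ 1)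
    (W : GaugeField (F.P K) 0 (Matrix.specialUnitaryGroup (Fin 2) ℂ)) (hreg : RegPr F n K ε₀ W)
    (A : PBond (F.P K) 0 → Matrix (Fin 2) (Fin 2) ℂ) (c : PBond (F.P n) 0)
    (hg : ‖(((frameTw F n K h W A c.tgt)⁻¹ * frameTwS F n K h W A c.tgt : (Matrix (Fin 2) (Fin 2) ℂ)ˣ) : Matrix (Fin 2) (Fin 2) ℂ) - 1‖ < 1 / 2) :
    ‖mlog ((descendToGL F n K h (bgUnits F K W) c * ((frameTw F n K h W A c.tgt)⁻¹ * frameTwS F n K h W A c.tgt)⁻¹ * (descendToGL F n K h (bgUnits F K W) c)⁻¹ :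
            (Matrix (Fin 2) (Fin 2) ℂ)ˣ) : Matrix (Fin 2) (Fin 2) ℂ)
        - -(((descendToGL F n K h (bgUnits F K W) c : (Matrix (Fin 2) (Fin 2) ℂ)ˣ) : Matrix (Fin 2) (Fin 2) ℂ)
          * (fderiv ℂ (fun A : PBond (F.P K) 0 → Matrix (Fin 2) (Fin 2) ℂ => ((frameTwS F n K h W A c.tgt : (Matrix (Fin 2) (Fin 2) ℂ)ˣ) : Matrix (Fin 2) (Fin 2) ℂ)) 0 A
              - fderiv ℂ (fun A : PBond (F.P K) 0 → Matrix (Fin 2) (Fin 2) ℂ => ((frameTw F n K h W A c.tgt : (Matrix (Fin 2) (Fin 2) ℂ)ˣ) : Matrix (Fin 2) (Fin 2) ℂ)) 0 A)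
          * (((descendToGL F n K h (bgUnits F K W) c)⁻¹ : (Matrix (Fin 2) (Fin 2) ℂ)ˣ) : Matrix (Fin 2) (Fin 2) ℂ))‖
      = ‖mlog ((((frameTw F n K h W A c.tgt)⁻¹ * frameTwS F n K h W A c.tgt : (Matrix (Fin 2) (Fin 2) ℂ)ˣ) : Matrix (Fin 2) (Fin 2) ℂ))
          - (fderiv ℂ (fun A : PBond (F.P K) 0 → Matrix (Fin 2) (Fin 2) ℂ => ((frameTwS F n K h W A c.tgt : (Matrix (Fin 2) (Fin 2) ℂ)ˣ) : Matrix (Fin 2) (Fin 2) ℂ)) 0 A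
              - fderiv ℂ (fun A : PBond (F.P K) 0 → Matrix (Fin 2) (Fin 2) ℂ => ((frameTw F n K h W A c.tgt : (Matrix (Fin 2) (Fin 2) ℂ)ˣ) : Matrix (Fin 2) (Fin 2) ℂ)) 0 A)‖ := by
  have hu : descendToGL F n K h (bgUnits F K W) c ∈ specialUnitaryUnits (Fin 2) :=
    descendToGL_bgUnits_mem_specialUnitaryUnits_of_regPr F h hε₀ hε7 W hreg c
  rw [mlog_conj_inv_sub_neg_conj_eq _ _ hg, norm_neg, norm_units_conj_eq_of_mem_specialUnitaryUnits hu]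

/-- ★ **(R1) FROM (R0)**: `Σ_c ‖mlog ↑g_A(c₋) − (r_s − r_c)(c₋)A‖ ≤ 3·Σ_y ρ y` — each site is the initial point of `d = 3` positive bonds (✓`sum_pbond_src`).
[cite: Balaban1985Averaging, (5) p.18, (89)-(92) p.31] -/
theorem sum_R1_le (W : GaugeField (F.P K) 0 (Matrix.specialUnitaryGroup (Fin 2) ℂ)) (A : PBond (F.P K) 0 → Matrix (Fin 2) (Fin 2) ℂ)
    (ρ : Site (F.P n) 0 → ℝ)
    (hR0 : ∀ y : Site (F.P n) 0, ‖mlog ((((frameTw F n K h W A y)⁻¹ * frameTwS F n K h W A y : (Matrix (Fin 2) (Fin 2) ℂ)ˣ) : Matrix (Fin 2) (Fin 2) ℂ))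
          - (fderiv ℂ (fun A : PBond (F.P K) 0 → Matrix (Fin 2) (Fin 2) ℂ => ((frameTwS F n K h W A y : (Matrix (Fin 2) (Fin 2) ℂ)ˣ) : Matrix (Fin 2) (Fin 2) ℂ)) 0 A
              - fderiv ℂ (fun A : PBond (F.P K) 0 → Matrix (Fin 2) (Fin 2) ℂ => ((frameTw F n K h W A y : (Matrix (Fin 2) (Fin 2) ℂ)ˣ) : Matrix (Fin 2) (Fin 2) ℂ)) 0 A)‖ ≤ ρ y) :
    ∑ c : PBond (F.P n) 0, ‖mlog ((((frameTw F n K h W A c.src)⁻¹ * frameTwS F n K h W A c.src : (Matrix (Fin 2) (Fin 2) ℂ)ˣ) : Matrix (Fin 2) (Fin 2) ℂ))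
          - (fderiv ℂ (fun A : PBond (F.P K) 0 → Matrix (Fin 2) (Fin 2) ℂ => ((frameTwS F n K h W A c.src : (Matrix (Fin 2) (Fin 2) ℂ)ˣ) : Matrix (Fin 2) (Fin 2) ℂ)) 0 A
              - fderiv ℂ (fun A : PBond (F.P K) 0 → Matrix (Fin 2) (Fin 2) ℂ => ((frameTw F n K h W A c.src : (Matrix (Fin 2) (Fin 2) ℂ)ˣ) : Matrix (Fin 2) (Fin 2) ℂ)) 0 A)‖
      ≤ 3 * ∑ y : Site (F.P n) 0, ρ y := by
  have hd : ((F.P n).d : ℝ) = 3 := by exact_mod_cast T3Family.P_d F n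
  calc ∑ c : PBond (F.P n) 0, ‖mlog ((((frameTw F n K h W A c.src)⁻¹ * frameTwS F n K h W A c.src : (Matrix (Fin 2) (Fin 2) ℂ)ˣ) : Matrix (Fin 2) (Fin 2) ℂ))
          - (fderiv ℂ (fun A : PBond (F.P K) 0 → Matrix (Fin 2) (Fin 2) ℂ => ((frameTwS F n K h W A c.src : (Matrix (Fin 2) (Fin 2) ℂ)ˣ) : Matrix (Fin 2) (Fin 2) ℂ)) 0 A
              - fderiv ℂ (fun A : PBond (F.P K) 0 → Matrix (Fin 2) (Fin 2) ℂ => ((frameTw F n K h W A c.src : (Matrix (Fin 2) (Fin 2) ℂ)ˣ) : Matrix (Fin 2) (Fin 2) ℂ)) 0 A)‖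
      ≤ ∑ c : PBond (F.P n) 0, ρ c.src := Finset.sum_le_sum fun c _ => hR0 c.src
    _ = 3 * ∑ y : Site (F.P n) 0, ρ y := by rw [sum_pbond_src (fun y => ρ y), hd]

/-- ★ **(R2) FROM (R0)**: at `RegPr F n K ε₀ W` (`10⁷L³ε₀ ≤ 1`) and under (Rp) with `p ≤ 1∕60`, `Σ_c ‖mlog ↑(D̄₀(c)·g_A(c₊)⁻¹·D̄₀(c)⁻¹) − ℓ₂ c‖ ≤ 3·Σ_y ρ y` — §2's identity bond by bond, then each
site is the final point of `d = 3` positive bonds (✓`sum_pbond_tgt`). [cite: Balaban1985Averaging, (5) p.18, (89)-(92) p.31, (26)-(27) p.22] -/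
theorem sum_R2_le {ε₀ : ℝ} (hε₀ : 0 < ε₀) (hε7 : 10 ^ 7 * (F.L : ℝ) ^ 3 * ε₀ ≤ 1)
    (W : GaugeField (F.P K) 0 (Matrix.specialUnitaryGroup (Fin 2) ℂ)) (hreg : RegPr F n K ε₀ W)
    (A : PBond (F.P K) 0 → Matrix (Fin 2) (Fin 2) ℂ)
    (p : Site (F.P n) 0 → ℝ)
    (hp : ∀ y, ‖(((frameTw F n K h W A y)⁻¹ * frameTwS F n K h W A y : (Matrix (Fin 2) (Fin 2) ℂ)ˣ) : Matrix (Fin 2) (Fin 2) ℂ) - 1‖ ≤ p y)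
    (hp' : ∀ y, p y ≤ 1 / 60)
    (ρ : Site (F.P n) 0 → ℝ)
    (hR0 : ∀ y : Site (F.P n) 0, ‖mlog ((((frameTw F n K h W A y)⁻¹ * frameTwS F n K h W A y : (Matrix (Fin 2) (Fin 2) ℂ)ˣ) : Matrix (Fin 2) (Fin 2) ℂ))
          - (fderiv ℂ (fun A : PBond (F.P K) 0 → Matrix (Fin 2) (Fin 2) ℂ => ((frameTwS F n K h W A y : (Matrix (Fin 2) (Fin 2) ℂ)ˣ) : Matrix (Fin 2) (Fin 2) ℂ)) 0 A
              - fderiv ℂ (fun A : PBond (F.P K) 0 → Matrix (Fin 2) (Fin 2) ℂ => ((frameTw F n K h W A y : (Matrix (Fin 2) (Fin 2) ℂ)ˣ) : Matrix (Fin 2) (Fin 2) ℂ)) 0 A)‖ ≤ ρ y) :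
    ∑ c : PBond (F.P n) 0, ‖mlog ((descendToGL F n K h (bgUnits F K W) c * ((frameTw F n K h W A c.tgt)⁻¹ * frameTwS F n K h W A c.tgt)⁻¹ * (descendToGL F n K h (bgUnits F K W) c)⁻¹ :
            (Matrix (Fin 2) (Fin 2) ℂ)ˣ) : Matrix (Fin 2) (Fin 2) ℂ)
        - -(((descendToGL F n K h (bgUnits F K W) c : (Matrix (Fin 2) (Fin 2) ℂ)ˣ) : Matrix (Fin 2) (Fin 2) ℂ)
          * (fderiv ℂ (fun A : PBond (F.P K) 0 → Matrix (Fin 2) (Fin 2) ℂ => ((frameTwS F n K h W A c.tgt : (Matrix (Fin 2) (Fin 2) ℂ)ˣ) : Matrix (Fin 2) (Fin 2) ℂ)) 0 A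
              - fderiv ℂ (fun A : PBond (F.P K) 0 → Matrix (Fin 2) (Fin 2) ℂ => ((frameTw F n K h W A c.tgt : (Matrix (Fin 2) (Fin 2) ℂ)ˣ) : Matrix (Fin 2) (Fin 2) ℂ)) 0 A)
          * (((descendToGL F n K h (bgUnits F K W) c)⁻¹ : (Matrix (Fin 2) (Fin 2) ℂ)ˣ) : Matrix (Fin 2) (Fin 2) ℂ))‖
      ≤ 3 * ∑ y : Site (F.P n) 0, ρ y := by
  have hd : ((F.P n).d : ℝ) = 3 := by exact_mod_cast T3Family.P_d F n
  have hlt : ∀ y, ‖(((frameTw F n K h W A y)⁻¹ * frameTwS F n K h W A y : (Matrix (Fin 2) (Fin 2) ℂ)ˣ) : Matrix (Fin 2) (Fin 2) ℂ) - 1‖ < 1 / 2 :=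
    fun y => (hp y).trans_lt (by linarith [hp' y])
  calc ∑ c : PBond (F.P n) 0, ‖mlog ((descendToGL F n K h (bgUnits F K W) c * ((frameTw F n K h W A c.tgt)⁻¹ * frameTwS F n K h W A c.tgt)⁻¹ * (descendToGL F n K h (bgUnits F K W) c)⁻¹ :
            (Matrix (Fin 2) (Fin 2) ℂ)ˣ) : Matrix (Fin 2) (Fin 2) ℂ)
        - -(((descendToGL F n K h (bgUnits F K W) c : (Matrix (Fin 2) (Fin 2) ℂ)ˣ) : Matrix (Fin 2) (Fin 2) ℂ)
          * (fderiv ℂ (fun A : PBond (F.P K) 0 → Matrix (Fin 2) (Fin 2) ℂ => ((frameTwS F n K h W A c.tgt : (Matrix (Fin 2) (Fin 2) ℂ)ˣ) : Matrix (Fin 2) (Fin 2) ℂ)) 0 A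
              - fderiv ℂ (fun A : PBond (F.P K) 0 → Matrix (Fin 2) (Fin 2) ℂ => ((frameTw F n K h W A c.tgt : (Matrix (Fin 2) (Fin 2) ℂ)ˣ) : Matrix (Fin 2) (Fin 2) ℂ)) 0 A)
          * (((descendToGL F n K h (bgUnits F K W) c)⁻¹ : (Matrix (Fin 2) (Fin 2) ℂ)ˣ) : Matrix (Fin 2) (Fin 2) ℂ))‖
      ≤ ∑ c : PBond (F.P n) 0, ρ c.tgt := Finset.sum_le_sum fun c _ => by
          rw [norm_R2_summand_eq F h hε₀ hε7 W hreg A c (hlt c.tgt)]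
          exact hR0 c.tgt
    _ = 3 * ∑ y : Site (F.P n) 0, ρ y := by rw [sum_pbond_tgt (fun y => ρ y), hd]

end Rows

/-! ## §3 ★★★ The (β) door with one analytic row -/

section Door

variable (F : T3Family) {n K : ℕ} (h : n ≤ K)

/-- ★★★ **THE (β) DOOR WITH ONE ANALYTIC ROW** — `Σ_c ‖C^{tw}(A)(c) − C^{twS}(A)(c)‖ ≤ 6·Σ_y ρ y + Σ_c [4(p c₋ + z c)² + 4(p c₋ + z c + p c₋·z c + 2p c₊)²]`: ✓px18's BCH door
`sum_norm_CmapTw_sub_CmapTwS_le` with (RL) discharged by ★routeR-w2's ✓`QTw_sub_QTwS_apply_eq_descendToGL`, (Rq) by (Rp) (§1: `q c := 2p c₊`), and (R1)(R2) by the ONE per-site row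
(R0) `‖mlog ↑g_A(y) − (r_s − r_c)(y)A‖ ≤ ρ y` (§2).  DISPLAYED: `RegPr F n K ε₀ W` with the LEG windows `10¹⁰L⁶ε₀ ≤ 1`, `10¹²L³ε₀ ≤ 1`; `A` bondwise skew-adjoint traceless; the sup windows
(Rp) `p ≤ 1∕60`, (Rz) `z ≤ 1∕30`; (R0).  The analytic content of (R0) in E2E currency is NOT here (LOCATE: L, two towers).
[cite: Balaban1985Averaging, (26)-(27) p.22, (89)-(92) p.31, (125)-(127) p.36, (5) p.18; Balaban1985Variational, (44)-(48) p.285; Balaban1985BackgroundPropagators, (3.14)-(3.15) p.393] -/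
theorem sum_norm_CmapTw_sub_CmapTwS_le_of_siteRow {ε₀ : ℝ} (hε₀ : 0 < ε₀) (hε : 10 ^ 10 * (F.L : ℝ) ^ 6 * ε₀ ≤ 1) (hε12 : 10 ^ 12 * (F.L : ℝ) ^ 3 * ε₀ ≤ 1)
    (W : GaugeField (F.P K) 0 (Matrix.specialUnitaryGroup (Fin 2) ℂ)) (hreg : RegPr F n K ε₀ W)
    (A : PBond (F.P K) 0 → Matrix (Fin 2) (Fin 2) ℂ) (hA : ∀ b, A b ∈ skewAdjoint (Matrix (Fin 2) (Fin 2) ℂ)) (htr : ∀ b, (A b).trace = 0)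
    (p : Site (F.P n) 0 → ℝ) (z : PBond (F.P n) 0 → ℝ)
    (hp : ∀ y, ‖(((frameTw F n K h W A y)⁻¹ * frameTwS F n K h W A y : (Matrix (Fin 2) (Fin 2) ℂ)ˣ) : Matrix (Fin 2) (Fin 2) ℂ) - 1‖ ≤ p y)
    (hz : ∀ c, ‖((dbarTwS F n K h W A c : (Matrix (Fin 2) (Fin 2) ℂ)ˣ) : Matrix (Fin 2) (Fin 2) ℂ) - 1‖ ≤ z c)
    (hp' : ∀ y, p y ≤ 1 / 60) (hz' : ∀ c, z c ≤ 1 / 30)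
    (ρ : Site (F.P n) 0 → ℝ)
    (hR0 : ∀ y : Site (F.P n) 0, ‖mlog ((((frameTw F n K h W A y)⁻¹ * frameTwS F n K h W A y : (Matrix (Fin 2) (Fin 2) ℂ)ˣ) : Matrix (Fin 2) (Fin 2) ℂ))
          - (fderiv ℂ (fun A : PBond (F.P K) 0 → Matrix (Fin 2) (Fin 2) ℂ => ((frameTwS F n K h W A y : (Matrix (Fin 2) (Fin 2) ℂ)ˣ) : Matrix (Fin 2) (Fin 2) ℂ)) 0 A
              - fderiv ℂ (fun A : PBond (F.P K) 0 → Matrix (Fin 2) (Fin 2) ℂ => ((frameTw F n K h W A y : (Matrix (Fin 2) (Fin 2) ℂ)ˣ) : Matrix (Fin 2) (Fin 2) ℂ)) 0 A)‖ ≤ ρ y) :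
    ∑ c : PBond (F.P n) 0, ‖CmapTw F n K h W A c - CmapTwS F n K h W A c‖ ≤
      6 * ∑ y : Site (F.P n) 0, ρ y
        + ∑ c : PBond (F.P n) 0, (4 * (p c.src + z c) ^ 2 + 4 * (p c.src + z c + p c.src * z c + 2 * p c.tgt) ^ 2) := by
  have hε7 : 10 ^ 7 * (F.L : ℝ) ^ 3 * ε₀ ≤ 1 := ten7_of_ten12 F hε₀.le hε12
  have hu : ∀ c : PBond (F.P n) 0, descendToGL F n K h (bgUnits F K W) c ∈ specialUnitaryUnits (Fin 2) :=
    fun c => descendToGL_bgUnits_mem_specialUnitaryUnits_of_regPr F h hε₀ hε7 W hreg c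
  have hq : ∀ c : PBond (F.P n) 0,
      ‖((descendToGL F n K h (bgUnits F K W) c * ((frameTw F n K h W A c.tgt)⁻¹ * frameTwS F n K h W A c.tgt)⁻¹ * (descendToGL F n K h (bgUnits F K W) c)⁻¹ :
            (Matrix (Fin 2) (Fin 2) ℂ)ˣ) : Matrix (Fin 2) (Fin 2) ℂ) - 1‖ ≤ 2 * p c.tgt :=
    fun c => norm_units_conj_inv_sub_one_le (hu c) (hp c.tgt) (by linarith [hp' c.tgt])
  have h1 := sum_R1_le F h W A ρ hR0
  have h2 := sum_R2_le F h hε₀ hε7 W hreg A p hp hp' ρ hR0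
  have hdoor := sum_norm_CmapTw_sub_CmapTwS_le F n K h W A
    (fun c => fderiv ℂ (fun A : PBond (F.P K) 0 → Matrix (Fin 2) (Fin 2) ℂ => ((frameTwS F n K h W A c.src : (Matrix (Fin 2) (Fin 2) ℂ)ˣ) : Matrix (Fin 2) (Fin 2) ℂ)) 0 A
          - fderiv ℂ (fun A : PBond (F.P K) 0 → Matrix (Fin 2) (Fin 2) ℂ => ((frameTw F n K h W A c.src : (Matrix (Fin 2) (Fin 2) ℂ)ˣ) : Matrix (Fin 2) (Fin 2) ℂ)) 0 A)
    (fun c => -(((descendToGL F n K h (bgUnits F K W) c : (Matrix (Fin 2) (Fin 2) ℂ)ˣ) : Matrix (Fin 2) (Fin 2) ℂ)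
          * (fderiv ℂ (fun A : PBond (F.P K) 0 → Matrix (Fin 2) (Fin 2) ℂ => ((frameTwS F n K h W A c.tgt : (Matrix (Fin 2) (Fin 2) ℂ)ˣ) : Matrix (Fin 2) (Fin 2) ℂ)) 0 A
              - fderiv ℂ (fun A : PBond (F.P K) 0 → Matrix (Fin 2) (Fin 2) ℂ => ((frameTw F n K h W A c.tgt : (Matrix (Fin 2) (Fin 2) ℂ)ˣ) : Matrix (Fin 2) (Fin 2) ℂ)) 0 A)
          * (((descendToGL F n K h (bgUnits F K W) c)⁻¹ : (Matrix (Fin 2) (Fin 2) ℂ)ˣ) : Matrix (Fin 2) (Fin 2) ℂ)))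
    (fun c => QTw_sub_QTwS_apply_eq_descendToGL F h hε₀ hε hε12 W hreg A hA htr c)
    p z (fun c => 2 * p c.tgt) hp hz hq (fun y => by linarith [hp' y]) hz' (fun c => by linarith [hp' c.tgt]) h1 h2
  linarith [hdoor]

end Door

end Summit.QuantumFields.YangMills.Theorems.Prop7CombSymR12OfSiteRow

end
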